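import Mathlib
import HarnessLib
import Literature.MathematicalPhysics.StatisticalMechanics.RenormalisationMapActivityABKM
import Literature.MathematicalPhysics.StatisticalMechanics.RelevantHamiltonianSpace
import Literature.MathematicalPhysics.StatisticalMechanics.StepOperatorABKM
import Literature.MathematicalPhysics.StatisticalMechanics.StepOperatorAGamma
import Literature.MathematicalPhysics.StatisticalMechanics.StepOperatorBABKM
import Literature.Dynamics.Hyperbolic.RGFlowStableManifoldReduced

/-!
# The renormalisation-group steps of [ABKM19] on the torus satisfy the hypotheses `RGFlow.IsRGStepQ`
# of the fine-tuning engine (Theorem 6.8 in the form consumed by Ch. 12)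

The fine-tuning engine `Literature.Dynamics.Hyperbolic.RGFlowStableManifoldReduced` (Theorem 12.1 /
Lemma 12.6 with the irrelevant coordinates measured by norm-bound predicates) consumes a family of
Banach spaces `E k`, additive groups `F k` with predicates `Q k`, and steps
`T_k(x, y) = (A_k x + B_k y, S_k(x, y))` subject to `RGFlow.IsRGStepQ N r α β σ Q A B S`.  This file
instantiates them with the concrete data of [ABKM19] on `(ℤ/L^N)^d`:

* `E k = HamSpace ℂ d 𝔥_k L^k L^{dk}` (relevant Hamiltonians with `‖·‖_{k,0}`),
  `F k = activitySpace P k`, `Q = activityNormLE P` (`‖·‖_k^{(A)}`), `P = abkmNormParams …`;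
* `abkmStepData L R k 𝒞` — the step data `(L^k, L, 𝒞_{k+1}, B₀ = B_0, c₀)`;
* `rgA` — `A_k = stepOpAEquiv (γ(𝒞_{k+1}))`; `rgB` — `B_k = opBHom` read in `E (k+1)`;
  `rgS` — `S_k(x, y) = restrictConn (L^{k+1}) (nextKStep D_k x (mulExt y))` (as a member of
  `activitySpace P (k+1)` when it is one, which is the case on the `r`-ball; `0` otherwise);
* **`isRGStepQ_abkm`** — `RGFlow.IsRGStepQ N r (3/4) (L^d C_{8.7} A_𝒫 A^{−1}) σ(r) Q rgA rgB rgS` under the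
  hypotheses of the weight theorem, `r ≤ 1/64` and the four conditions on `(r, A)` of
  `RenormalisationMapBallABKM` (`map_zero`: `nextKStep_zero_trivAct`; `lipschitz`:
  `weakNormLE_nextKStep_sub_abkm_ball`; `norm_symm_le`: Lemma 10.5 `hamNorm_stepOpAInv_abkm_le`;
  `norm_B_le`: Lemma 10.6 `hamNorm_opB_abkm_le`).

Everything is proved; no named fact.  Not here: `σ(r) ≤ κη` (choice of `L`, `A`, `r`), the
`q`-dependence of the steps (Lemma 12.6's Lipschitz hypotheses), the representation of `𝒵`.

## References
* S. Adams, S. Buchholz, R. Kotecký, S. Müller, arXiv:1910.13564, Theorem 6.8, Lemmas 10.5–10.6,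
  Ch. 12 (12.1)–(12.4) [AdamsBuchholzKoteckyMuller2019].
-/

noncomputable section

namespace Literature.MathematicalPhysics.StatisticalMechanics.GradientRG

open scoped BigOperators Classical
open Finset MeasureTheory
open Literature.MathematicalPhysics.StatisticalMechanics.TorusPolymer
  (IsPolymer blocks polys bprod blockOf thicken reblock boxCorner mem_polys mem_blocks numBlocks isPolymer_blockOf
    card_blocks_eq_numBlocks blocks_blockOf empty_mem_polys closure mem_blockOf_self isConn_blockOf)
open Literature.Barriers.CriticalPhenomena.LongRangePhi4.Polymer (IsConn components)
open Literature.MathematicalPhysics.StatisticalMechanics.GradientFRD (iterDiff)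
open Literature.MathematicalPhysics.QuantumFieldTheory
open Literature.Dynamics.Hyperbolic

variable {d M : ℕ} [NeZero M]

/-! ## The concrete step data, the steps `A_k`, `B_k`, `S_k` -/

/-- **The step data of scale `k`**: block side `L^k`, ratio `L`, kernel `𝒞_{k+1}`, reference block
`B_0 = blockOf (L^k) 0` and the corner of its box `B_0*`. [cite: AdamsBuchholzKoteckyMuller2019, Definition 6.5] -/
def abkmStepData (L R k : ℕ) (𝒞 : ℕ → (Fin d → ZMod M) → ℝ) : StepData d M :=
  ⟨L ^ k, L, 𝒞 (k + 1), boxCorner (L ^ k) (starRad R L d k) 0, blockOf (L ^ k) 0⟩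

/-- **`A_k`** — the linear step of the relevant coordinate, `stepOpAEquiv γ(𝒞_{k+1})` between the
coefficient spaces of scales `k` and `k+1`. [cite: AdamsBuchholzKoteckyMuller2019, Theorem 6.8 (6.56)] -/
def rgA (L : ℕ) (h : ℝ) (𝒞 : ℕ → (Fin d → ZMod M) → ℝ) [∀ j : ℕ, Fact (0 < fieldWt h (L : ℝ) d j)] [∀ j : ℕ, Fact (0 < (L : ℝ) ^ j)] [∀ j : ℕ, Fact (0 < L ^ (d * j))] (k : ℕ) :
    HamSpace ℂ d (fieldWt h (L : ℝ) d k) ((L : ℝ) ^ k) (L ^ (d * k)) ≃L[ℝ] HamSpace ℂ d (fieldWt h (L : ℝ) d (k + 1)) ((L : ℝ) ^ (k + 1)) (L ^ (d * (k + 1))) :=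
  stepOpAEquiv (𝕜 := ℂ) (fieldWt h (L : ℝ) d k) ((L : ℝ) ^ k) (L ^ (d * k))
    (fieldWt h (L : ℝ) d (k + 1)) ((L : ℝ) ^ (k + 1)) (L ^ (d * (k + 1))) (gradCov (𝒞 (k + 1)))

/-- **`B_k`** — `K ↦ −Π₂ R_{k+1} K(B_0)` as an additive map into the coefficient space of scale `k+1`
(`opBHom`; `0` beyond the horizon `k > N`). [cite: AdamsBuchholzKoteckyMuller2019, Theorem 6.8 (the operator B_k)] -/
def rgB {L N Mord R n p r₀ : ℕ} {θbar lam μ δ₁ δ₀ A𝒫 h A : ℝ} {𝒞 : ℕ → (Fin d → ZMod M) → ℝ}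
    (hθbar : 0 < θbar) (hlam : 0 < lam)
    (hB : AbkmWeightBounds L N Mord R n θbar lam μ δ₁ δ₀ A𝒫 𝒞
      (abkmWeightData L N Mord R θbar (schedDelta δ₀ δ₁ N) 𝒞))
    (hr₀ : 2 ≤ r₀) (hLodd : Odd L) (hM : M = L ^ N) (k : ℕ) :
    activitySpace (abkmNormParams L N Mord R p r₀ h θbar A (schedDelta δ₀ δ₁ N) 𝒞) k →+ HamSpace ℂ d (fieldWt h (L : ℝ) d (k + 1)) ((L : ℝ) ^ (k + 1)) (L ^ (d * (k + 1))) :=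
  if hk : k + 1 ≤ N + 1 then
    (HamSpace.ofHam (𝕜 := ℂ) (d := d) (𝔥 := fieldWt h (L : ℝ) d (k + 1)) (R := (L : ℝ) ^ (k + 1))
        (n := L ^ (d * (k + 1)))).toLinearMap.toAddMonoidHom.comp
      (opBHom (p := p) (A := A) hθbar hlam hB hk hr₀ hLodd hM (abkmStepData L R k 𝒞) rfl (x₀ := 0) rfl)
  else 0

/-- **`S_k(x, y)`** — the irrelevant step: `restrictConn (L^{k+1}) (nextKStep D_k x (mulExt y))` bundled as a
member of `activitySpace P (k+1)` when it is one (`restrictConn_nextKStep_mem_activitySpace` on the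
`r`-ball), `0` otherwise. [cite: AdamsBuchholzKoteckyMuller2019, Definition 6.5 (6.34) / Theorem 6.8] -/
def rgS {L N Mord R p r₀ : ℕ} {h θbar A δ₀ δ₁ : ℝ} {𝒞 : ℕ → (Fin d → ZMod M) → ℝ} (k : ℕ)
    (x : HamSpace ℂ d (fieldWt h (L : ℝ) d k) ((L : ℝ) ^ k) (L ^ (d * k))) (y : activitySpace (abkmNormParams L N Mord R p r₀ h θbar A (schedDelta δ₀ δ₁ N) 𝒞) k) : activitySpace (abkmNormParams L N Mord R p r₀ h θbar A (schedDelta δ₀ δ₁ N) 𝒞) (k + 1) :=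
  if hmem : restrictConn (L ^ (k + 1)) (nextKStep (abkmStepData L R k 𝒞) (HamSpace.toHam x)
      (mulExt (y : Finset (Fin d → ZMod M) → ((Fin d → ZMod M) → ℝ) → ℂ))) ∈ activitySpace (abkmNormParams L N Mord R p r₀ h θbar A (schedDelta δ₀ δ₁ N) 𝒞) (k + 1) then
    ⟨_, hmem⟩ else 0

/-- The value of `S_k(x, y)` when the image is admissible. [cite: AdamsBuchholzKoteckyMuller2019, Theorem 6.8] -/
theorem coe_rgS_of_mem {L N Mord R p r₀ : ℕ} {h θbar A δ₀ δ₁ : ℝ} {𝒞 : ℕ → (Fin d → ZMod M) → ℝ} {k : ℕ}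
    {x : HamSpace ℂ d (fieldWt h (L : ℝ) d k) ((L : ℝ) ^ k) (L ^ (d * k))} {y : activitySpace (abkmNormParams L N Mord R p r₀ h θbar A (schedDelta δ₀ δ₁ N) 𝒞) k}
    (hmem : restrictConn (L ^ (k + 1)) (nextKStep (abkmStepData L R k 𝒞) (HamSpace.toHam x)
      (mulExt (y : Finset (Fin d → ZMod M) → ((Fin d → ZMod M) → ℝ) → ℂ))) ∈ activitySpace (abkmNormParams L N Mord R p r₀ h θbar A (schedDelta δ₀ δ₁ N) 𝒞) (k + 1)) :
    ((rgS k x y : activitySpace (abkmNormParams L N Mord R p r₀ h θbar A (schedDelta δ₀ δ₁ N) 𝒞) (k + 1)) : Finset (Fin d → ZMod M) → ((Fin d → ZMod M) → ℝ) → ℂ) =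
      restrictConn (L ^ (k + 1)) (nextKStep (abkmStepData L R k 𝒞) (HamSpace.toHam x)
        (mulExt (y : Finset (Fin d → ZMod M) → ((Fin d → ZMod M) → ℝ) → ℂ))) := by
  unfold rgS; rw [dif_pos hmem]

/-- A weak-norm bound is non-negative (read off at the reference block).
[cite: AdamsBuchholzKoteckyMuller2019, Ch. 6.4 (6.50)] -/
theorem nonneg_of_weakNormLE {P : NormParams d M} (hA : 0 < P.A) {k t : ℕ} (hMt : M = P.L ^ k * t)
    (hs : Odd (P.L ^ k)) (ht : Odd t) {K : Finset (Fin d → ZMod M) → ((Fin d → ZMod M) → ℝ) → ℂ} {C : ℝ}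
    (hK : WeakNormLE P k K C) : 0 ≤ C := by
  have hMo : Odd M := by rw [hMt]; exact hs.mul ht
  have h1 := (hK (blockOf (P.L ^ k) 0) (isPolymer_blockOf _ _) (isConn_blockOf hMo hs 0)) 0
  have h2 : 0 ≤ C * P.aFactor k (blockOf (P.L ^ k) 0) :=
    (mul_nonneg_iff_of_pos_right (P.W.weight_pos k _ 0)).1 ((tayNorm_nonneg _ _ _ _).trans h1)
  exact (mul_nonneg_iff_of_pos_right (WeakNormLE.aFactor_pos hA k _)).1 h2

/-- The minimum of two weak-norm bounds is a weak-norm bound. [cite: AdamsBuchholzKoteckyMuller2019, Ch. 6.4 (6.50)] -/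
theorem WeakNormLE.min {P : NormParams d M} (hA : 0 < P.A) {k : ℕ}
    {K : Finset (Fin d → ZMod M) → ((Fin d → ZMod M) → ℝ) → ℂ} {C C' : ℝ}
    (h₁ : WeakNormLE P k K C) (h₂ : WeakNormLE P k K C') : WeakNormLE P k K (min C C') := by
  intro X hX hc φ
  have e := le_min (h₁ X hX hc φ) (h₂ X hX hc φ)
  rwa [← min_mul_of_nonneg _ _ (P.W.weight_pos k X φ).le,
    ← min_mul_of_nonneg _ _ (WeakNormLE.aFactor_pos hA k X).le] at e

/-! ## `IsRGStepQ` for the concrete data -/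

set_option maxHeartbeats 800000 in
/-- **[ABKM19] Theorem 6.8 in the form `RGFlow.IsRGStepQ`** (module docstring): for `d ≥ 3`, `L` odd,
`L ≥ 2^{d+3} + 16R`, `M = L^N`, the weight tower of Theorem 7.1 (`AbkmWeightBounds`) with kernel regularity,
`A ≥ 1` large and `r ≤ 1/64` small in the sense of the four conditions of `RenormalisationMapBallABKM`,
the steps `(rgA, rgB, rgS)` satisfy `IsRGStepQ N r (3/4) (L^d C_{8.7} A_𝒫 A^{−1}) σ(r)` for the
predicates `activityNormLE P`. [cite: AdamsBuchholzKoteckyMuller2019, Theorem 6.8] -/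
theorem isRGStepQ_abkm {L N Mord R n p r₀ : ℕ} {θbar lam μ δ₁ δ₀ A𝒫 h A : ℝ}
    {𝒞 : ℕ → (Fin d → ZMod M) → ℝ} [∀ j : ℕ, Fact (0 < fieldWt h (L : ℝ) d j)] [∀ j : ℕ, Fact (0 < (L : ℝ) ^ j)] [∀ j : ℕ, Fact (0 < L ^ (d * j))]
    (hd : 3 ≤ d) (hn : 2 ≤ n) (hLodd : Odd L) (hL : 2 ^ (d + 3) + 16 * R ≤ L)
    (hR2 : 2 ≤ R) (hM : M = L ^ N)
    (hp : d / 2 + 2 ≤ p) (hpM : p + d ≤ Mord) (hMR : Mord ≤ R) (hr₀ : 3 ≤ r₀)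
    (hθbar : 0 < θbar) (hlam : 0 < lam)
    (hB : AbkmWeightBounds L N Mord R n θbar lam μ δ₁ δ₀ A𝒫 𝒞
      (abkmWeightData L N Mord R θbar (schedDelta δ₀ δ₁ N) 𝒞))
    (hδ₀ : 0 < δ₀) (hδ₁ : 0 < δ₁) (hh : 0 < h) (hh0 : hZeroSq d R δ₀ δ₁ ≤ h ^ 2)
    {Cα : (Fin d → ℕ) → ℝ}
    (hCα : ∀ j, 1 ≤ j → j ≤ N + 1 → ∀ θ' : Fin d → ℕ, ∑ i, θ' i ≤ n →
      ∀ x, |iterDiff θ' (𝒞 j) x| ≤ Cα θ' / (L : ℝ) ^ ((j - 1) * (d - 2 + ∑ i, θ' i)))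
    (hh2 : secondDiffConst Cα ≤ h ^ 2) (hA𝒫 : 0 ≤ A𝒫) (hA1 : 1 ≤ A)
    (hA𝒫A : A𝒫 ≤ A)
    (hsmall : (2 : ℝ) ^ (L ^ d) * (A𝒫 * A ^ (-(1 - (1 + 1 / ((2 * (2 ^ d + 1) + 6 : ℝ) ^ d))⁻¹) : ℝ)) ≤ 1)
    {r : ℝ} (hr0 : 0 ≤ r) (hr : r ≤ 1 / 64)
    (hv : vABKM d R A A𝒫 r ≤ 1 / 64) (hωA : omegaABKM d R A A𝒫 r * A ^ 2 ≤ 1)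
    (hc3A : (kappaABKM d R A A𝒫 r) ^ (L ^ d) * ((2 * (2 * (kappaABKM d R A A𝒫 r) * max 1 A𝒫)) ^ ((2 ^ (d + 1) + 2) ^ d * L ^ d) * (4 : ℝ) ^ ((2 ^ (d + 1) + 2) ^ d * L ^ d)) ≤ A ^ ((1 + 1 / ((2 * (2 ^ d + 1) + 6 : ℝ) ^ d)) - 1 : ℝ))
    (hc2A : (kappaABKM d R A A𝒫 r) ^ (L ^ d) * ((2 * (kappaABKM d R A A𝒫 r) * max 1 A𝒫) ^ ((2 ^ (d + 1) + 2) ^ d * L ^ d) * (2 : ℝ) ^ ((2 ^ (d + 1) + 2) ^ d * L ^ d)) ≤ A ^ ((1 + 1 / ((2 * (2 ^ d + 1) + 6 : ℝ) ^ d)) - 1 : ℝ)) :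
    RGFlow.IsRGStepQ (E := fun k => HamSpace ℂ d (fieldWt h (L : ℝ) d k) ((L : ℝ) ^ k) (L ^ (d * k))) (F := fun k => activitySpace (abkmNormParams L N Mord R p r₀ h θbar A (schedDelta δ₀ δ₁ N) 𝒞) k)
      N r (3 / 4) ((L : ℝ) ^ d * (pi2BoundConst d (((2 * R + 2 : ℕ) : ℝ) + ((d / 2 + 1 : ℕ) : ℝ)) * (A𝒫 * A⁻¹))) (sigmaABKM d L R A A𝒫 r)
      (activityNormLE (abkmNormParams L N Mord R p r₀ h θbar A (schedDelta δ₀ δ₁ N) 𝒞)) (rgA L h 𝒞) (rgB (p := p) (A := A) hθbar hlam hB (by omega) hLodd hM)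
      (rgS (L := L) (N := N) (Mord := Mord) (R := R) (p := p) (r₀ := r₀) (h := h) (θbar := θbar) (A := A)
        (δ₀ := δ₀) (δ₁ := δ₁) (𝒞 := 𝒞)) := by
  set P := (abkmNormParams L N Mord R p r₀ h θbar A (schedDelta δ₀ δ₁ N) 𝒞) with hP
  have hd2 : 2 ≤ d := by omega
  have h8 : 8 ≤ 2 ^ (d + 3) := by
    calc 8 = 2 ^ 3 := by norm_num
      _ ≤ 2 ^ (d + 3) := Nat.pow_le_pow_right (by norm_num) (by omega)
  have hL4 : 4 ≤ L := by omega
  have hL1 : 1 ≤ L := by omega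
  have hL0 : (0 : ℝ) < L := by exact_mod_cast hLodd.pos
  have hA0 : 0 < A := by linarith
  have hPA : 0 < P.A := hA0
  have hMo : Odd M := by rw [hM]; exact hLodd.pow
  have hC87_0 : 0 ≤ pi2BoundConst d (((2 * R + 2 : ℕ) : ℝ) + ((d / 2 + 1 : ℕ) : ℝ)) := pi2BoundConst_nonneg d (by positivity)
  have hσ0 : 0 ≤ sigmaABKM d L R A A𝒫 r := sigmaABKM_nonneg hLodd.pos hA1 hA𝒫 hr0
  -- per-scale facts
  have hDs : ∀ k, (abkmStepData L R k 𝒞).s = L ^ k := fun k => rfl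
  have hDL : ∀ k, (abkmStepData L R k 𝒞).L = L := fun k => rfl
  have hD𝒞 : ∀ k, (abkmStepData L R k 𝒞).𝒞 = 𝒞 (k + 1) := fun k => rfl
  have hB₀ : ∀ k, (abkmStepData L R k 𝒞).B₀ = blockOf (L ^ k) 0 := fun k => rfl
  have hc₀ : ∀ k, (abkmStepData L R k 𝒞).c₀ = boxCorner (L ^ k) (starRad R L d k) 0 := fun k => rfl
  have hB0ne : ∀ k, (abkmStepData L R k 𝒞).B₀ ≠ ∅ := fun k => Finset.ne_empty_of_mem (mem_blockOf_self (L ^ k) 0)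
  have hMt : ∀ k, k ≤ N → M = P.L ^ k * L ^ (N - k) := fun k hk => by
    show M = L ^ k * L ^ (N - k)
    rw [hM, ← pow_add, Nat.add_sub_cancel' hk]
  refine ⟨?_, ?_, ?_, ?_⟩
  · -- `S_k(0, 0) = 0`
    intro k hk
    have hz : restrictConn (L ^ (k + 1)) (nextKStep (abkmStepData L R k 𝒞)
        (HamSpace.toHam (0 : HamSpace ℂ d (fieldWt h (L : ℝ) d k) ((L : ℝ) ^ k) (L ^ (d * k))))
        (mulExt (((0 : activitySpace P k) : activitySpace P k) : Finset (Fin d → ZMod M) → ((Fin d → ZMod M) → ℝ) → ℂ))) = 0 := by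
      rw [map_zero, Submodule.coe_zero, mulExt_zero]
      funext U
      by_cases hU : IsPolymer (L ^ (k + 1)) U ∧ IsConn U
      · rw [restrictConn_of_conn hU.1 hU.2]
        funext φ
        rw [nextKStep_zero_trivAct _ (hB0ne k) U φ]
        unfold TorusPolymer.punit
        rw [if_neg (Finset.nonempty_iff_ne_empty.1 hU.2.1)]
        rfl
      · rw [restrictConn_of_not hU]; rfl
    unfold rgS
    split_ifs with hmem
    · exact Subtype.ext hz
    · rfl
  · -- the Lipschitz bound on the `r`-ball
    intro k hk x x' y y' cy cy' c hx hx' hy hcy hy' hcy' hyy'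
    have hkN : k + 1 ≤ N := hk
    have hsodd : Odd (L ^ k) := hLodd.pow
    set D := abkmStepData L R k 𝒞 with hDdef
    set H := HamSpace.toHam x with hHdef
    set H' := HamSpace.toHam x' with hH'def
    set K := mulExt ((y : activitySpace P k) : Finset (Fin d → ZMod M) → ((Fin d → ZMod M) → ℝ) → ℂ) with hKdef
    set K' := mulExt ((y' : activitySpace P k) : Finset (Fin d → ZMod M) → ((Fin d → ZMod M) → ℝ) → ℂ) with hK'def
    have hH : hamNorm (fieldWt h (L : ℝ) d k) ((L : ℝ) ^ k) (L ^ (d * k)) H ≤ r := by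
      rw [hHdef, ← HamSpace.norm_def]; exact hx
    have hH' : hamNorm (fieldWt h (L : ℝ) d k) ((L : ℝ) ^ k) (L ^ (d * k)) H' ≤ r := by
      rw [hH'def, ← HamSpace.norm_def]; exact hx'
    have hK : WeakNormLE P k K r := (activitySpace.weakNormLE_mulExt y hy).mono hPA hcy
    have hK' : WeakNormLE P k K' r := (activitySpace.weakNormLE_mulExt y' hy').mono hPA hcy'
    have hKd : ∀ Y, ContDiff ℝ r₀ (K Y) := activitySpace.contDiff_mulExt y
    have hK'd : ∀ Y, ContDiff ℝ r₀ (K' Y) := activitySpace.contDiff_mulExt y'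
    have hc0 : 0 ≤ c := nonneg_of_weakNormLE hPA (hMt k (by omega)) hsodd hLodd.pow hyy'
    have hΔ1 : WeakNormLE P k (K - K') c := activitySpace.weakNormLE_mulExt_sub y y' hyy'
    have hΔ2 : WeakNormLE P k (K - K') (r + r) := hK.sub hK' hKd hK'd
    have hΔ : WeakNormLE P k (K - K') (min c (r + r)) := WeakNormLE.min hPA hΔ1 hΔ2
    have hCΔ : 0 ≤ min c (r + r) := le_min hc0 (by linarith)
    have hCΔ2 : min c (r + r) ≤ 2 * r := (min_le_right _ _).trans (by linarith)
    have hk1L : 1 ≤ L ^ k := Nat.one_le_pow _ _ hLodd.pos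
    have hKfac : Factorises (L ^ k) K := factorises_mulExt hk1L
    have hK'fac : Factorises (L ^ k) K' := factorises_mulExt hk1L
    have hK0 : ∀ φ, K ∅ φ = 1 := fun φ => mulExt_empty φ
    have hK'0 : ∀ φ, K' ∅ φ = 1 := fun φ => mulExt_empty φ
    have hKloc : ∀ Y, IsPolymer (L ^ k) Y → IsConn Y → IsGaugeLocal (P.gauge k Y) (K Y) :=
      fun Y hY hYc => activitySpace.isGaugeLocal_mulExt y hY hYc
    have hK'loc : ∀ Y, IsPolymer (L ^ k) Y → IsConn Y → IsGaugeLocal (P.gauge k Y) (K' Y) :=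
      fun Y hY hYc => activitySpace.isGaugeLocal_mulExt y' hY hYc
    have hKt : TransInv (L ^ k) K := activitySpace.transInv_mulExt y
    have hK't : TransInv (L ^ k) K' := activitySpace.transInv_mulExt y'
    -- membership of the two images
    have hmem : restrictConn (L ^ (k + 1)) (nextKStep D H K) ∈ activitySpace P (k + 1) :=
      restrictConn_nextKStep_mem_activitySpace hd hn hLodd hL hR2 hM hkN hp hpM hMR hr₀ hθbar hlam hB hδ₀ hδ₁ hh hh0
        hCα hh2 hA𝒫 hA1 hA𝒫A hsmall D (hDs k) (hDL k) (hD𝒞 k) (hB₀ k) (hc₀ k) hH hr hK hKfac hK0 hKd hKloc hKt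
        hv hωA hc3A hc2A
    have hmem' : restrictConn (L ^ (k + 1)) (nextKStep D H' K') ∈ activitySpace P (k + 1) :=
      restrictConn_nextKStep_mem_activitySpace hd hn hLodd hL hR2 hM hkN hp hpM hMR hr₀ hθbar hlam hB hδ₀ hδ₁ hh hh0
        hCα hh2 hA𝒫 hA1 hA𝒫A hsmall D (hDs k) (hDL k) (hD𝒞 k) (hB₀ k) (hc₀ k) hH' hr hK' hK'fac hK'0 hK'd hK'loc hK't
        hv hωA hc3A hc2A
    -- the Lipschitz estimate
    have hlip := weakNormLE_nextKStep_sub_abkm_ball hd hn hLodd hL hR2 hM hkN hp hpM hMR hr₀ hθbar hlam hB hδ₀ hδ₁ hh hh0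
      hCα hh2 hA𝒫 hA1 hA𝒫A hsmall D (hDs k) (hDL k) (hD𝒞 k) (hB₀ k) (hc₀ k) hH hH' hr hCΔ hK hK' hΔ hCΔ2 hKfac hK0
      hK'fac hK'0 hKd hK'd hKloc hK'loc hKt hK't hv hωA hc3A hc2A
    have hxx' : hamNorm (fieldWt h (L : ℝ) d k) ((L : ℝ) ^ k) (L ^ (d * k)) (H - H') = ‖x - x'‖ := by
      rw [HamSpace.norm_def, hHdef, hH'def, map_sub]
    have hle : sigmaABKM d L R A A𝒫 r * max (hamNorm (fieldWt h (L : ℝ) d k) ((L : ℝ) ^ k) (L ^ (d * k)) (H - H')) (min c (r + r)) ≤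
        sigmaABKM d L R A A𝒫 r * max ‖x - x'‖ c := by
      rw [hxx']
      exact mul_le_mul_of_nonneg_left (max_le_max le_rfl (min_le_left _ _)) hσ0
    show WeakNormLE P (k + 1) (((rgS k x y - rgS k x' y' : activitySpace P (k + 1)) :
      Finset (Fin d → ZMod M) → ((Fin d → ZMod M) → ℝ) → ℂ)) (sigmaABKM d L R A A𝒫 r * max ‖x - x'‖ c)
    rw [Submodule.coe_sub, coe_rgS_of_mem hmem, coe_rgS_of_mem hmem', ← restrictConn_sub]
    exact (weakNormLE_restrictConn_iff (P := P) (k := k + 1)).2 (hlip.mono hPA hle)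
  · -- `‖A_k⁻¹‖ ≤ 3/4`
    intro k hk w
    rw [HamSpace.norm_def, HamSpace.norm_def]
    unfold rgA
    rw [toHam_stepOpAEquiv_symm]
    exact hamNorm_stepOpAInv_abkm_le hd hL4 hh k
      (fun q => (abs_gradCov_abkm_le hd2 hn hL1 hCα (by omega : k + 1 ≤ N + 1) q).trans hh2) _
  · -- `‖B_k y‖ ≤ β ‖y‖_k`
    intro k hk y c hyc
    have hk1 : k + 1 ≤ N + 1 := by omega
    have hc0 : 0 ≤ c := nonneg_of_weakNormLE hPA (hMt k (by omega)) hLodd.pow hLodd.pow hyc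
    rw [HamSpace.norm_def]
    unfold rgB
    rw [dif_pos hk1]
    show hamNorm (fieldWt h (L : ℝ) d (k + 1)) ((L : ℝ) ^ (k + 1)) (L ^ (d * (k + 1)))
      (HamSpace.toHam (HamSpace.ofHam (opBHom (p := p) (A := A) hθbar hlam hB hk1 (by omega) hLodd hM
        (abkmStepData L R k 𝒞) rfl (x₀ := 0) rfl y))) ≤ _
    rw [HamSpace.toHam_ofHam, opBHom_apply]
    calc hamNorm (fieldWt h (L : ℝ) d (k + 1)) ((L : ℝ) ^ (k + 1)) (L ^ (d * (k + 1)))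
          (opB (abkmStepData L R k 𝒞) (y : Finset (Fin d → ZMod M) → ((Fin d → ZMod M) → ℝ) → ℂ))
        ≤ (L : ℝ) ^ d * (pi2BoundConst d (((2 * R + 2 : ℕ) : ℝ) + ((d / 2 + 1 : ℕ) : ℝ)) * (c * A𝒫 * A⁻¹)) :=
          hamNorm_opB_abkm_le hd hLodd hL hM hk hpM hMR hr₀ hθbar hlam hB hh hA1 (abkmStepData L R k 𝒞) rfl rfl rfl hc0
            hyc (activitySpace.contDiff y) (fun X hX hXc => activitySpace.isGaugeLocal y hX hXc)
      _ = (L : ℝ) ^ d * (pi2BoundConst d (((2 * R + 2 : ℕ) : ℝ) + ((d / 2 + 1 : ℕ) : ℝ)) * (A𝒫 * A⁻¹)) * c := by ring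

end Literature.MathematicalPhysics.StatisticalMechanics.GradientRG

end
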